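import Summits.HubbardSuperconductivity.HubbardSuperconductivity.Theorems.AnisotropyChordTransferFibre3B1EvalTxG
import Summits.HubbardSuperconductivity.HubbardSuperconductivity.Theorems.AnisotropyChordTransferFibre3L2Vars

/-!
# Route `AnisotropyChord` / H0 rotor rung, LEVEL 2 cell evaluator for the t-BLOCKS `L₀ ≤ L ≤ L₁`: the block cell `L2.TCell`
and its box bridge ★ `TCell.point_mem_box`

`…Fibre3L2Vars` fixes the sixteen-variable vector `L2.point L λ₂ a` of the Level-2 rows and the per-`ν`-cell certificate
`L2.NamedCell` whose box has the HARD-CODED first slot `theta2Box = [0, θ²(128)]` and whose check is `B1.cellCheck 128`/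
`B1.txCellCheck` — the `∀ L ≥ 128` campaign.  Route-lead ruling R1 covers `48 ≤ L < 128` by L-free certificates in t-BLOCKS
(`t = θ² = (2π/L)²` in a block interval).  THIS FILE is the block analogue of `L2Vars`, nothing else changes downstream
(every Level-2 program runs on a `Box`; p3's `n1CellCheckCB`, `endCheckB`/`finalCheckB` are Box-generic):
* `L2.TCell` — block floor `L₀`, block top `L₁` (`0` = none), the t-slot `[tlo, thi]`, and the `NamedCell` data (cell
  `ν ∈ [n₁/νd, n₂/νd]`, `T = Tn/Td ≥ θ₀²` with `θ₀ = 2π/L₀`, denominator `D`, twelve brackets at window `K = L₀/4`);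
* `TCell.check` — `0 < L₀`, `(2·piHi/L₀)² ≤ thi`, `tlo ≤ 0 ∨ (0 < L₁ ∧ tlo·L₁² ≤ 4·piLo²)`, ten `B1.cellCheck L₀`, two
  `B1.txCellCheckG L₀`;  `TCell.box a₁ a₂ : Box` (sixteen slots, slot 0 = `[tlo, thi]`);
* ★ `TCell.point_mem_box`: `c.check = true`, `c.L₀ ≤ L`, `c.L₁ = 0 ∨ L ≤ c.L₁`, `ν ∈` cell, `a ∈ [a₁, a₂]` ⟹
  `(c.box a₁ a₂).mem (point L λ₂ a)`;  `TCell.box_length`.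
Bracket widths per block (exact mirror `b1certG.py`, session p2 g8): `θ⁴S₂` .041/.059/.11/.19, `θ⁴Tx` .072/.12/.27/.50 at
`L₀ = 128/96/64/48`; zero-order `N₁` loss from `L ≥ 128` to `[48,64)`: ≤ .015 (ν ≈ .005) … .085 (ν ≈ .03) (STATUS REPORT 1).
Prover seat `hubbard-h0-rotor-p2` g8; helper for piece A = stmt-HubbardSuperconductivity-23918 of rung 19089
(`--supports`, helper class).  Nothing here proves superconductivity in the Hubbard model; helper definitions/lemmas of ONE
conditional reduction (the GM₃ ∀L certificate, Level-2 rows on t-blocks); the rotor TARGET as originally worded stays FALSE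
(g15 verdict).  Mathlib + the tree only; no sorry.
-/

set_option linter.dupNamespace false
set_option autoImplicit false

open scoped BigOperators
open Literature.Analysis.ValidatedNumerics

namespace Summit.HubbardSuperconductivity.HubbardSuperconductivity.Theorems.AnisotropyChord.Transfer.Fibre3.L2

/-! ## The block cell -/

/-- the data of one `ν`-cell of a t-BLOCK `L₀ ≤ L ≤ L₁` (`L₁ = 0`: no top): the t-slot `[tlo, thi]` (`t = θ²`), the cell
`ν ∈ [n₁/νd, n₂/νd]`, `T = Tn/Td ≥ θ₀²` (`θ₀ = 2π/L₀`), the rounding denominator `D`, and the twelve claimed brackets of the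
normalised named sums at window `K = L₀/4`. -/
structure TCell where
  /-- block floor and top (`L₁ = 0` means no top) -/
  L0 : ℕ
  L1 : ℕ
  /-- the `t = θ²` slot -/
  tlo : ℚ
  thi : ℚ
  /-- cell numerators and the common denominator -/
  n1 : ℤ
  n2 : ℤ
  νd : ℤ
  /-- the rational `T = Tn/Td ≥ θ₀²` -/
  Tn : ℤ
  Td : ℤ
  /-- the rounding denominator -/
  D : ℕ
  /-- brackets of `θ⁴S₂, θ⁶S₃, θ⁸S₄, θ⁴T10, θ⁴T11, θ⁶G21, θ⁶G12, θ⁸G22, θ⁸G31, θ⁸G13, θ⁴Tx(1,0), θ⁴Tx(1,1)` -/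
  bS2 : ℚ × ℚ
  bS3 : ℚ × ℚ
  bS4 : ℚ × ℚ
  bT10 : ℚ × ℚ
  bT11 : ℚ × ℚ
  bG21 : ℚ × ℚ
  bG12 : ℚ × ℚ
  bG22 : ℚ × ℚ
  bG31 : ℚ × ℚ
  bG13 : ℚ × ℚ
  bTx10 : ℚ × ℚ
  bTx11 : ℚ × ℚ

/-- the block checks: scales of the t-slot, and the twelve kernel certificates at `L₀` (`B1.cellCheck L₀`, `B1.txCellCheckG L₀`). -/
def TCell.check (c : TCell) : Bool :=
  decide (0 < c.L0) && decide ((2 * B1.piHi / c.L0) ^ 2 ≤ c.thi) &&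
  (decide (c.tlo ≤ 0) || (decide (0 < c.L1) && decide (c.tlo * (c.L1 : ℚ) ^ 2 ≤ 4 * Hole2.piLo ^ 2))) &&
  B1.cellCheck c.L0 c.n1 c.n2 c.νd c.Tn c.Td 0 ![((0 : ℤ), (0 : ℤ))] ![2] 2 c.D c.bS2.1 c.bS2.2 &&
  B1.cellCheck c.L0 c.n1 c.n2 c.νd c.Tn c.Td 0 ![((0 : ℤ), (0 : ℤ))] ![3] 3 c.D c.bS3.1 c.bS3.2 &&
  B1.cellCheck c.L0 c.n1 c.n2 c.νd c.Tn c.Td 0 ![((0 : ℤ), (0 : ℤ))] ![4] 4 c.D c.bS4.1 c.bS4.2 &&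
  B1.cellCheck c.L0 c.n1 c.n2 c.νd c.Tn c.Td 1 ![((0 : ℤ), (0 : ℤ)), (1, 0)] ![1, 1] 2 c.D c.bT10.1 c.bT10.2 &&
  B1.cellCheck c.L0 c.n1 c.n2 c.νd c.Tn c.Td 1 ![((0 : ℤ), (0 : ℤ)), (1, 1)] ![1, 1] 2 c.D c.bT11.1 c.bT11.2 &&
  B1.cellCheck c.L0 c.n1 c.n2 c.νd c.Tn c.Td 1 ![((0 : ℤ), (0 : ℤ)), (1, 0)] ![2, 1] 3 c.D c.bG21.1 c.bG21.2 &&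
  B1.cellCheck c.L0 c.n1 c.n2 c.νd c.Tn c.Td 1 ![((0 : ℤ), (0 : ℤ)), (1, 0)] ![1, 2] 3 c.D c.bG12.1 c.bG12.2 &&
  B1.cellCheck c.L0 c.n1 c.n2 c.νd c.Tn c.Td 1 ![((0 : ℤ), (0 : ℤ)), (1, 0)] ![2, 2] 4 c.D c.bG22.1 c.bG22.2 &&
  B1.cellCheck c.L0 c.n1 c.n2 c.νd c.Tn c.Td 1 ![((0 : ℤ), (0 : ℤ)), (1, 0)] ![3, 1] 4 c.D c.bG31.1 c.bG31.2 &&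
  B1.cellCheck c.L0 c.n1 c.n2 c.νd c.Tn c.Td 1 ![((0 : ℤ), (0 : ℤ)), (1, 0)] ![1, 3] 4 c.D c.bG13.1 c.bG13.2 &&
  B1.txCellCheckG c.L0 c.n1 c.n2 c.νd c.Tn c.Td ((1 : ℤ), (0 : ℤ)) c.D c.bTx10.1 c.bTx10.2 &&
  B1.txCellCheckG c.L0 c.n1 c.n2 c.νd c.Tn c.Td ((1 : ℤ), (1 : ℤ)) c.D c.bTx11.1 c.bTx11.2

/-- the box of a block cell over the sixteen variables (`a ∈ [a₁, a₂]` supplied by the caller; slot 0 = the t-slot). -/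
def TCell.box (c : TCell) (a1 a2 : ℚ) : Box :=
  [(c.tlo, c.thi), pi2Box, ((c.n1 : ℚ) / c.νd, (c.n2 : ℚ) / c.νd), (a1, a2),
    c.bS2, c.bS3, c.bS4, c.bT10, c.bT11, c.bG21, c.bG12, c.bG22, c.bG31, c.bG13, c.bTx10, c.bTx11]

/-- the block box has sixteen slots. -/
theorem TCell.box_length (c : TCell) (a1 a2 : ℚ) : (c.box a1 a2).length = 16 := by
  simp [TCell.box]

/-! ## The bridge -/

noncomputable section

/-- the t-slot: `tlo ≤ θ² ≤ thi` for `L₀ ≤ L` (and `L ≤ L₁` when `L₁ ≠ 0`), from the two scale checks. [folklore] -/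
theorem TCell.theta_sq_mem (c : TCell) (hL0p : 0 < c.L0) (hthi : (2 * B1.piHi / c.L0) ^ 2 ≤ c.thi)
    (htlo : c.tlo ≤ 0 ∨ (0 < c.L1 ∧ c.tlo * (c.L1 : ℚ) ^ 2 ≤ 4 * Hole2.piLo ^ 2))
    (L : ℕ) [NeZero L] (hL : c.L0 ≤ L) (hL1 : c.L1 = 0 ∨ L ≤ c.L1) :
    ((c.tlo : ℚ) : ℝ) ≤ (2 * Real.pi / L) ^ 2 ∧ (2 * Real.pi / L) ^ 2 ≤ ((c.thi : ℚ) : ℝ) := by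
  have hpi := Real.pi_pos
  have hP : Real.pi ≤ ((B1.piHi : ℚ) : ℝ) := by
    have e : ((B1.piHi : ℚ) : ℝ) = 3.1416 := by unfold B1.piHi; norm_num
    rw [e]
    exact Real.pi_lt_d4.le
  have hPlo : ((Hole2.piLo : ℚ) : ℝ) ≤ Real.pi := (Hole2.pi_mem).1.le
  have hPlo0 : (0 : ℝ) ≤ ((Hole2.piLo : ℚ) : ℝ) := by unfold Hole2.piLo; push_cast; norm_num
  have hL0R : (0 : ℝ) < c.L0 := by exact_mod_cast hL0p
  have hLR : (c.L0 : ℝ) ≤ L := by exact_mod_cast hL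
  have hLpos : (0 : ℝ) < L := lt_of_lt_of_le hL0R hLR
  constructor
  · rcases htlo with h0 | ⟨hL1p, ht⟩
    · have : ((c.tlo : ℚ) : ℝ) ≤ 0 := by exact_mod_cast h0
      exact this.trans (sq_nonneg _)
    · have hL1 : L ≤ c.L1 := by
        rcases hL1 with h | h
        · omega
        · exact h
      have hL1R : (L : ℝ) ≤ c.L1 := by exact_mod_cast hL1
      have htR : ((c.tlo : ℚ) : ℝ) * (c.L1 : ℝ) ^ 2 ≤ 4 * ((Hole2.piLo : ℚ) : ℝ) ^ 2 := by exact_mod_cast ht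
      have h1 : ((c.tlo : ℚ) : ℝ) * (L : ℝ) ^ 2 ≤ 4 * Real.pi ^ 2 := by
        by_cases hc : ((c.tlo : ℚ) : ℝ) ≤ 0
        · have : ((c.tlo : ℚ) : ℝ) * (L : ℝ) ^ 2 ≤ 0 := mul_nonpos_of_nonpos_of_nonneg hc (sq_nonneg _)
          nlinarith
        · push Not at hc
          have h2 : ((c.tlo : ℚ) : ℝ) * (L : ℝ) ^ 2 ≤ ((c.tlo : ℚ) : ℝ) * (c.L1 : ℝ) ^ 2 :=
            mul_le_mul_of_nonneg_left (pow_le_pow_left₀ hLpos.le hL1R 2) hc.le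
          have h3 : ((Hole2.piLo : ℚ) : ℝ) ^ 2 ≤ Real.pi ^ 2 := pow_le_pow_left₀ hPlo0 hPlo 2
          linarith
      have e : (2 * Real.pi / L) ^ 2 = 4 * Real.pi ^ 2 / (L : ℝ) ^ 2 := by
        field_simp; ring
      rw [e, le_div_iff₀ (by positivity)]
      exact h1
  · have h1 : 2 * Real.pi / L ≤ 2 * Real.pi / c.L0 := div_le_div_of_nonneg_left (by positivity) hL0R hLR
    have h2 : 2 * Real.pi / c.L0 ≤ 2 * ((B1.piHi : ℚ) : ℝ) / c.L0 :=
      div_le_div_of_nonneg_right (by linarith) hL0R.le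
    have h3 : (2 * Real.pi / L) ^ 2 ≤ (2 * ((B1.piHi : ℚ) : ℝ) / c.L0) ^ 2 :=
      pow_le_pow_left₀ (by positivity) (h1.trans h2) 2
    have h4 : (2 * ((B1.piHi : ℚ) : ℝ) / c.L0) ^ 2 ≤ ((c.thi : ℚ) : ℝ) := by exact_mod_cast hthi
    exact h3.trans h4

/-- ★★ **THE BLOCK BOX BRIDGE**: a checked block cell's box contains the true variable vector for every `L` of the block
(`c.L₀ ≤ L`, and `L ≤ c.L₁` unless `c.L₁ = 0`), every `λ₂` with `ν = λ₂/θ²` in the cell and every `a ∈ [a₁, a₂]`. -/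
theorem TCell.point_mem_box (c : TCell) (hc : c.check = true) (a1 a2 : ℚ) (L : ℕ) [NeZero L] (hL : c.L0 ≤ L)
    (hL1 : c.L1 = 0 ∨ L ≤ c.L1) (lam2 a : ℝ)
    (hν1 : (c.n1 : ℝ) / c.νd ≤ lam2 / (2 * Real.pi / L) ^ 2) (hν2 : lam2 / (2 * Real.pi / L) ^ 2 ≤ (c.n2 : ℝ) / c.νd)
    (ha1 : ((a1 : ℚ) : ℝ) ≤ a) (ha2 : a ≤ ((a2 : ℚ) : ℝ)) :
    (c.box a1 a2).mem (point L lam2 a) := by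
  unfold TCell.check at hc
  simp only [Bool.and_eq_true, Bool.or_eq_true, decide_eq_true_eq] at hc
  obtain ⟨⟨⟨⟨⟨⟨⟨⟨⟨⟨⟨⟨⟨⟨hL0p, hthi⟩, htlo⟩, hS2⟩, hS3⟩, hS4⟩, hT10⟩, hT11⟩, hG21⟩, hG12⟩, hG22⟩, hG31⟩, hG13⟩, hTx10⟩,
    hTx11⟩ := hc
  have hLpos : (0 : ℝ) < L := by exact_mod_cast (show 0 < L by omega)
  have hθpos : (0 : ℝ) < 2 * Real.pi / L := by positivity
  have hθ2 : (2 * Real.pi / L) ^ 2 ≠ 0 := by positivity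
  set ν : ℝ := lam2 / (2 * Real.pi / L) ^ 2 with hνdef
  have hlam : lam2 = ν * (2 * Real.pi / L) ^ 2 := by rw [hνdef, div_mul_cancel₀ _ hθ2]
  have eS2 := B1.cell_sound c.L0 c.n1 c.n2 c.νd c.Tn c.Td 0 _ _ 2 c.D _ _ hS2 L hL ν hν1 hν2
  have eS3 := B1.cell_sound c.L0 c.n1 c.n2 c.νd c.Tn c.Td 0 _ _ 3 c.D _ _ hS3 L hL ν hν1 hν2
  have eS4 := B1.cell_sound c.L0 c.n1 c.n2 c.νd c.Tn c.Td 0 _ _ 4 c.D _ _ hS4 L hL ν hν1 hν2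
  have eT10 := B1.cell_sound c.L0 c.n1 c.n2 c.νd c.Tn c.Td 1 _ _ 2 c.D _ _ hT10 L hL ν hν1 hν2
  have eT11 := B1.cell_sound c.L0 c.n1 c.n2 c.νd c.Tn c.Td 1 _ _ 2 c.D _ _ hT11 L hL ν hν1 hν2
  have eG21 := B1.cell_sound c.L0 c.n1 c.n2 c.νd c.Tn c.Td 1 _ _ 3 c.D _ _ hG21 L hL ν hν1 hν2
  have eG12 := B1.cell_sound c.L0 c.n1 c.n2 c.νd c.Tn c.Td 1 _ _ 3 c.D _ _ hG12 L hL ν hν1 hν2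
  have eG22 := B1.cell_sound c.L0 c.n1 c.n2 c.νd c.Tn c.Td 1 _ _ 4 c.D _ _ hG22 L hL ν hν1 hν2
  have eG31 := B1.cell_sound c.L0 c.n1 c.n2 c.νd c.Tn c.Td 1 _ _ 4 c.D _ _ hG31 L hL ν hν1 hν2
  have eG13 := B1.cell_sound c.L0 c.n1 c.n2 c.νd c.Tn c.Td 1 _ _ 4 c.D _ _ hG13 L hL ν hν1 hν2
  have eTx10 := B1.tx_cell_soundG c.L0 c.n1 c.n2 c.νd c.Tn c.Td _ c.D _ _ hTx10 L hL ν hν1 hν2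
  have eTx11 := B1.tx_cell_soundG c.L0 c.n1 c.n2 c.νd c.Tn c.Td _ c.D _ _ hTx11 L hL ν hν1 hν2
  rw [← hlam] at eS2 eS3 eS4 eT10 eT11 eG21 eG12 eG22 eG31 eG13 eTx10 eTx11
  have hθbox := c.theta_sq_mem hL0p hthi htlo L hL hL1
  have hπ := pi_sq_mem
  intro i
  unfold TCell.box Box.ivl
  match i with
  | 0 => simpa [point] using hθbox
  | 1 => simpa [point, pi2Box] using hπ
  | 2 => simpa [point] using ⟨hν1, hν2⟩
  | 3 => simpa [point] using ⟨ha1, ha2⟩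
  | 4 => simpa [point, S2n] using eS2
  | 5 => simpa [point, S3n] using eS3
  | 6 => simpa [point, S4n] using eS4
  | 7 => simpa [point, T10n] using eT10
  | 8 => simpa [point, T11n] using eT11
  | 9 => simpa [point, G21n] using eG21
  | 10 => simpa [point, G12n] using eG12
  | 11 => simpa [point, G22n] using eG22
  | 12 => simpa [point, G31n] using eG31
  | 13 => simpa [point, G13n] using eG13
  | 14 => simpa [point] using eTx10
  | 15 => simpa [point] using eTx11
  | n + 16 => simp [point]

end

end Summit.HubbardSuperconductivity.HubbardSuperconductivity.Theorems.AnisotropyChord.Transfer.Fibre3.L2
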